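import Summits.CriticalPhenomena.PercolationContinuityZ3.Theorems.PercNearOneGluingNoHeavyQuantSingleGateSureRelays
import HarnessLib

/-!
# QUANT lane R8, T-DEC, the q < 1 slice of `SingleGateConvClosed`: the COLUMN DECOMPOSITION of the gated convolution —
# `gate_q(μ₁ ∗ μ₂) = Σ_s μ₂(s)·gate_q(μ₁(· − s))` is a mixture of GATED SHIFTS of the first factor (the laws of Conjecture R), each DEC at
# every layer at its own mean `q·(T₁ + s)`; the columns hung at depth `s ≥ T₂` are DEC at the global target; lead g29's two-law form
# `(1−g)·ν + g·R_aν` of the blob case (V307) is the instance `μ₂ = {0, a; g}`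

builds on p205010 (kernel theorem, internal audit signed; external expert review pending)

Support file (`--supports stmt-CriticalPhenomena-4575`), QUANT lane seat prim-quant-arm-2 (gen 33), rung R8 of
`run/shared/lean/prim/quant/LADDER.md`; lane INBOX 2026-08-22T16:43Z (lead g29, V307).  Theorems only (no definitions), standard axioms, no sorries.
Companion of this seat's `…QuantSingleGatePointPieces` (rows hung under the points of the first factor's datum) and `…QuantSingleGateSureRelays`
(Conjecture R in the single-gate shape, `decAtT_gateShift_allLayers`).

WHAT.  Conditioning on the second factor, `gate_q(μ₁ ∗ μ₂)(h) = Σ_{s ≤ M₂} μ₂(s)·gate_q(μ₁(· − s))(h)` (`lconv_eq_columns`, `gateConv_eq_columns`):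
the gated convolution of `SingleGateConvClosed` is a mixture, weighted by the BARE second factor `μ₂`, of the gated shifts `gate_q(μ₁(· − s))` —
exactly the laws of Conjecture R, each DEC at EVERY layer at its own mean `q·(T₁ + s)` from the single-gate hypothesis on `μ₁` alone
(`decAtT_gateShift_allLayers`).  The conclusion asks DEC at the mixed target `q·(T₁ + T₂)`, `T₂ = Σ s·μ₂(s)` the mean of the weights: the LONG
columns (`s ≥ T₂`, more generally `q(T₁ + T₂) ≤ q(T₁ + s)`) are DEC there by antitonicity (`decAtT_longColumn`), the short ones (`s < T₂`) are
certified only at a lower target — the whole content of the q < 1 slice is the transfer of target surplus `q(s − T₂)` from long to short columns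
(`Σ_s μ₂(s)(s − T₂) = 0`), under the hypothesis that `gate_q μ₂` — the law of the column INDEX — is itself DEC at every layer.  For the blob
`μ₂ = {0, a; g}` there are two columns, `(1−g)·gate_q μ₁ + g·gate_q(μ₁(· − a))` (`gateConv_blob_eq_mixture`): lead g29's `pslice(ν,a,g) = (1−g)ν + g·R_aν`
with `ν = gate_q μ₁`, `R_aν = gate_q(μ₁(· − a))` (V307, statement (MT-R)); `gateConv_decAtT_of_columns` / `gateConv_blob_decAtT` are the (content-free)
reassemblies once every charged column is DEC at the common target.
HONEST STATUS: `SingleGateConvClosed`, (MT-R) and both slices remain OPEN; RATE class log\* and the honest sentence unchanged.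

* `LawDec.lconv_eq_columns`, `LawDec.gateConv_eq_columns` — the identities.
* **`LawDec.decAtT_longColumn`** — a column at depth `s` with `T ≤ q·(T₁ + s)` is `DECAtT y T J M′` at every layer (`M′ ≥ M₁ + s`).
* `LawDec.gateConv_decAtT_of_columns` — all charged columns DEC at `(y, T, j)` ⟹ `gate_q(μ₁ ∗ μ₂)` is.
* `LawDec.gateConv_blob_eq_mixture`, `LawDec.gateConv_blob_decAtT` — the two-column (blob) case.
* `LawDec.decAtT_gate_mono` — re-gating `q ↦ q′ ≥ q` is free at a fixed target (mixture of `gate μ q` and the de-gated `μ`);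
  **`LawDec.decAtT_zeroPiece_long`** — the over-gated (`γ ≥ q`) zero pieces `gate (μ₁(· − h)) γ` hung at depth `h ≥ T₁` are DEC at the global target.
* **`LawDec.decAtT_giantToppedPiece`** — a piece `{lo, hi; γ} ∗ μ₂` with `γ ≥ y` and `hi` above the working layer is DEC at ANY target (criterion E).

[this work]; Conjecture R: prim-quant-stmt g25/g26; single-gate binder: prim-quant-lead g28; two-law form of PM1: prim-quant-lead g29 (this lane).
Nothing here is cited as a published result.  The gluing rows served [cite: KozmaNitzan2024, Conjecture 3 (p. 15)]; product measure
[cite: Grimmett1999, §1.3 p. 10].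
-/

noncomputable section

namespace Summit.CriticalPhenomena.PercolationContinuityZ3.Theorems

namespace Quant

open Finset

namespace LawDec

/-! ### The column identities -/

/-- **conditioning on the second factor**: `lconv M₁ M₂ μ₁ μ₂ h = Σ_{s ≤ M₂} μ₂ s · μ₁(h − s)·[s ≤ h]` (`μ₁` vanishing above `M₁`). [this work] -/
theorem lconv_eq_columns (M₁ M₂ : ℕ) (μ₁ μ₂ : ℕ → ℝ) (h1M : ∀ h, M₁ < h → μ₁ h = 0) (h : ℕ) :
    lconv M₁ M₂ μ₁ μ₂ h = ∑ s ∈ Finset.range (M₂ + 1), μ₂ s * (if s ≤ h then μ₁ (h - s) else 0) := by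
  rw [lconv_comm]
  simp only [lconv]
  refine Finset.sum_congr rfl fun s _ => ?_
  by_cases hsh : s ≤ h
  · rw [if_pos hsh]
    by_cases hi : h - s ≤ M₁
    · rw [Finset.sum_eq_single_of_mem (h - s) (Finset.mem_range.2 (by omega)) (fun i _ hi' => if_neg (by omega)),
        if_pos (by omega)]
    · rw [h1M (h - s) (by omega), mul_zero]
      exact Finset.sum_eq_zero fun i hi' => if_neg (by have := Finset.mem_range.1 hi'; omega)
  · rw [if_neg hsh, mul_zero]
    exact Finset.sum_eq_zero fun i _ => if_neg (by omega)

/-- **THE COLUMN DECOMPOSITION OF THE GATED CONVOLUTION**: `gate (lconv M₁ M₂ μ₁ μ₂) q h = Σ_{s ≤ M₂} μ₂ s · gate (μ₁(· − s)) q h`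
(`μ₁` vanishing above `M₁`, `μ₂` of mass `1`; any real `q`) — a mixture, weighted by the bare `μ₂`, of the gated shifts of `μ₁`. [this work] -/
theorem gateConv_eq_columns (M₁ M₂ : ℕ) (μ₁ μ₂ : ℕ → ℝ) (q : ℝ) (h1M : ∀ h, M₁ < h → μ₁ h = 0)
    (hμ₂1 : ∑ s ∈ Finset.range (M₂ + 1), μ₂ s = 1) (h : ℕ) :
    gate (lconv M₁ M₂ μ₁ μ₂) q h
      = ∑ s ∈ Finset.range (M₂ + 1), μ₂ s * gate (fun t => if s ≤ t then μ₁ (t - s) else 0) q h := by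
  rw [gate_apply, lconv_eq_columns M₁ M₂ μ₁ μ₂ h1M h, Finset.mul_sum]
  simp only [gate_apply]
  have e : ∀ s, μ₂ s * (q * (if s ≤ h then μ₁ (h - s) else 0) + (1 - q) * (if h = 0 then (1 : ℝ) else 0))
      = q * (μ₂ s * (if s ≤ h then μ₁ (h - s) else 0)) + ((1 - q) * (if h = 0 then (1 : ℝ) else 0)) * μ₂ s :=
    fun s => by ring
  simp only [e]
  rw [Finset.sum_add_distrib, ← Finset.mul_sum, ← Finset.mul_sum, hμ₂1, mul_one]

/-! ### Long columns are DEC at the global target -/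

/-- **A LONG COLUMN IS DEC AT THE GLOBAL TARGET.**  `0 < y < 1`, `0 < q ≤ 1`, `y ≤ q`; `μ₁` a probability law on `{0..M₁}` (mean `T₁`) with
the single-gate hypothesis of `SingleGateConvClosed` (`y·M₁ ≤ q·T₁`, `DECAt y j′ M₁ (gate μ₁ q)` for `j′ < M₁`); a depth `s` and a target
`T ≤ q·(T₁ + s)`.  Then the column `gate (μ₁(· − s)) q` is `DECAtT y T J M′` at every layer `J`, for every top `M′ ≥ M₁ + s`. [this work] -/
theorem decAtT_longColumn (y q T : ℝ) (s M₁ M' : ℕ) (μ₁ : ℕ → ℝ) (hy0 : 0 < y) (hy1 : y < 1) (hq0 : 0 < q) (hq1 : q ≤ 1)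
    (hyq : y ≤ q) (hμ0 : ∀ h, 0 ≤ μ₁ h) (hμM : ∀ h, M₁ < h → μ₁ h = 0) (hμ1 : ∑ h ∈ Finset.range (M₁ + 1), μ₁ h = 1)
    (hta : y * (M₁ : ℝ) ≤ q * ∑ h ∈ Finset.range (M₁ + 1), (h : ℝ) * μ₁ h)
    (hS : ∀ j, j < M₁ → DECAt y j M₁ (gate μ₁ q)) (hM' : M₁ + s ≤ M')
    (hT : T ≤ q * (∑ h ∈ Finset.range (M₁ + 1), (h : ℝ) * μ₁ h + s)) (J : ℕ) :
    DECAtT y T J M' (gate (fun t => if s ≤ t then μ₁ (t - s) else 0) q) :=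
  decAtT_mono_top (decAtT_antitone_target hT
    (decAtT_gateShift_allLayers y q s M₁ μ₁ hy0 hy1 hq0 hq1 hyq hμ0 hμM hμ1 hta hS J)) hM'

/-! ### Reassembly over columns -/

/-- **REASSEMBLY OVER COLUMNS**: if every charged column `gate (μ₁(· − s)) q` (`s ≤ M₂`, `μ₂ s > 0`) is `DECAtT y T j M′`, then so is
`gate (lconv M₁ M₂ μ₁ μ₂) q` (`μ₂ ≥ 0` of mass `1`; `decAtT_finite_mixture`). [this work] -/
theorem gateConv_decAtT_of_columns (y T q : ℝ) (j M' M₁ M₂ : ℕ) (μ₁ μ₂ : ℕ → ℝ) (h1M : ∀ h, M₁ < h → μ₁ h = 0)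
    (hμ₂0 : ∀ s, 0 ≤ μ₂ s) (hμ₂1 : ∑ s ∈ Finset.range (M₂ + 1), μ₂ s = 1)
    (hdec : ∀ s, s ≤ M₂ → 0 < μ₂ s → DECAtT y T j M' (gate (fun t => if s ≤ t then μ₁ (t - s) else 0) q)) :
    DECAtT y T j M' (gate (lconv M₁ M₂ μ₁ μ₂) q) := by
  refine decAtT_finite_mixture y T j M' _ (fun s : Fin (M₂ + 1) => μ₂ s)
    (fun s t => gate (fun t => if (s : ℕ) ≤ t then μ₁ (t - s) else 0) q t) (fun s => hμ₂0 s) ?_ (fun h => ?_)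
    (fun s hs => hdec s (by omega) hs)
  · rw [Fin.sum_univ_eq_sum_range (fun s => μ₂ s) (M₂ + 1), hμ₂1]
  · rw [gateConv_eq_columns M₁ M₂ μ₁ μ₂ q h1M hμ₂1 h,
      ← Fin.sum_univ_eq_sum_range (fun s => μ₂ s * gate (fun t => if s ≤ t then μ₁ (t - s) else 0) q h) (M₂ + 1)]

/-! ### The blob second factor: two columns (lead g29's `(1−g)·ν + g·R_aν`) -/

/-- **THE BLOB CASE IS A TWO-LAW MIXTURE** (V307 in gate form): for `μ₂ = {0, a; g}` (`a ≥ 1`),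
`gate (lconv M₁ a μ₁ {0,a;g}) q = (1−g)·gate μ₁ q + g·gate (μ₁(· − a)) q` — with `ν = gate_q μ₁` and `R_aν = gate_q(μ₁(· − a))` this is
`pslice(ν, a, g) = (1−g)·ν + g·R_aν`. [this work] -/
theorem gateConv_blob_eq_mixture (M₁ a : ℕ) (μ₁ : ℕ → ℝ) (g q : ℝ) (ha : 1 ≤ a) (h1M : ∀ h, M₁ < h → μ₁ h = 0) (h : ℕ) :
    gate (lconv M₁ a μ₁ (fun k => g * (if k = a then (1 : ℝ) else 0) + (1 - g) * (if k = 0 then (1 : ℝ) else 0))) q h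
      = (1 - g) * gate μ₁ q h + g * gate (fun t => if a ≤ t then μ₁ (t - a) else 0) q h := by
  have hmass : ∑ s ∈ Finset.range (a + 1), (g * (if s = a then (1 : ℝ) else 0) + (1 - g) * (if s = 0 then (1 : ℝ) else 0)) = 1 := by
    rw [Finset.sum_add_distrib, ← Finset.mul_sum, ← Finset.mul_sum, Finset.sum_ite_eq' (Finset.range (a + 1)) a,
      if_pos (Finset.mem_range.2 (by omega)), Finset.sum_ite_eq' (Finset.range (a + 1)) 0, if_pos (Finset.mem_range.2 (by omega))]
    ring
  rw [gateConv_eq_columns M₁ a μ₁ _ q h1M hmass h]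
  have e : ∀ s, (g * (if s = a then (1 : ℝ) else 0) + (1 - g) * (if s = 0 then (1 : ℝ) else 0))
        * gate (fun t => if s ≤ t then μ₁ (t - s) else 0) q h
      = (if s = a then g * gate (fun t => if s ≤ t then μ₁ (t - s) else 0) q h else 0)
        + (if s = 0 then (1 - g) * gate (fun t => if s ≤ t then μ₁ (t - s) else 0) q h else 0) := by
    intro s
    split_ifs <;> ring
  rw [Finset.sum_congr rfl (fun s _ => e s), Finset.sum_add_distrib, Finset.sum_ite_eq' (Finset.range (a + 1)) a,
    if_pos (Finset.mem_range.2 (by omega)), Finset.sum_ite_eq' (Finset.range (a + 1)) 0, if_pos (Finset.mem_range.2 (by omega))]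
  have e0 : (fun t => if 0 ≤ t then μ₁ (t - 0) else 0) = μ₁ := by
    funext t; rw [if_pos (Nat.zero_le t), Nat.sub_zero]
  rw [e0]
  ring

/-- **reassembly, blob case**: if `gate μ₁ q` and `gate (μ₁(· − a)) q` are both `DECAtT y T j M′` (the COMMON target) then so is the gated
convolution with the blob `{0, a; g}` (`0 ≤ g ≤ 1`, `a ≥ 1`).  (MT-R)'s content is that the first law is given DEC only at the lower target
`q·T₁`; this lemma is the last line of any proof of it. [this work] -/
theorem gateConv_blob_decAtT (y T q g : ℝ) (j M' M₁ a : ℕ) (μ₁ : ℕ → ℝ) (ha : 1 ≤ a) (hg0 : 0 ≤ g) (hg1 : g ≤ 1)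
    (h1M : ∀ h, M₁ < h → μ₁ h = 0)
    (hν : DECAtT y T j M' (gate μ₁ q)) (hR : DECAtT y T j M' (gate (fun t => if a ≤ t then μ₁ (t - a) else 0) q)) :
    DECAtT y T j M' (gate (lconv M₁ a μ₁ (fun k => g * (if k = a then (1 : ℝ) else 0) + (1 - g) * (if k = 0 then (1 : ℝ) else 0))) q) := by
  have e : gate (lconv M₁ a μ₁ (fun k => g * (if k = a then (1 : ℝ) else 0) + (1 - g) * (if k = 0 then (1 : ℝ) else 0))) q
      = fun h => (1 - g) * gate μ₁ q h + (1 - (1 - g)) * gate (fun t => if a ≤ t then μ₁ (t - a) else 0) q h := by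
    funext h
    rw [gateConv_blob_eq_mixture M₁ a μ₁ g q ha h1M h]
    ring
  rw [e]
  exact decAtT_mixture (1 - g) (by linarith) (by linarith) hν hR

/-! ### Re-gating at a fixed target; long zero pieces -/

/-- **RE-GATING IS MONOTONE AT A FIXED TARGET**: `0 < x < 1`, `0 < q ≤ q′ ≤ 1`, `μ` a probability law on `{0..M}`: if `gate μ q` is
`DECAtT x T j′ M` then so is `gate μ q′` — `gate μ q′ = c·gate μ q + (1−c)·μ` with `c = (1−q′)/(1−q)`, and `μ` itself is DEC at the same
target (`decAtT_of_decAtT_gate`); `decAtT_mixture`. [this work] -/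
theorem decAtT_gate_mono (x T q q' : ℝ) (j' M : ℕ) (μ : ℕ → ℝ) (hx0 : 0 < x) (hx1 : x < 1) (hq0 : 0 < q) (hqq : q ≤ q')
    (hq1 : q' ≤ 1) (hμ0 : ∀ h, 0 ≤ μ h) (hμM : ∀ h, M < h → μ h = 0) (hμ1 : ∑ h ∈ Finset.range (M + 1), μ h = 1)
    (hdec : DECAtT x T j' M (gate μ q)) : DECAtT x T j' M (gate μ q') := by
  have hμ : DECAtT x T j' M μ := decAtT_of_decAtT_gate x T q j' M μ hx0 hx1 hq0 (hqq.trans hq1) hμ0 hμM hμ1 hdec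
  by_cases hq : q = 1
  · have hq' : q' = 1 := le_antisymm hq1 (hq ▸ hqq)
    rw [hq', gate_one]
    exact hμ
  · have hq1' : 0 < 1 - q := by
      have : q < 1 := lt_of_le_of_ne (hqq.trans hq1) hq
      linarith
    have hne : (1 : ℝ) - q ≠ 0 := ne_of_gt hq1'
    set c : ℝ := (1 - q') / (1 - q) with hc
    have hc0 : 0 ≤ c := div_nonneg (by linarith) hq1'.le
    have hc1 : c ≤ 1 := by rw [hc, div_le_one hq1']; linarith
    have e : gate μ q' = fun h => c * gate μ q h + (1 - c) * μ h := by
      funext h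
      rw [gate_apply, gate_apply, hc]
      field_simp
      ring
    rw [e]
    exact decAtT_mixture c hc0 hc1 hdec hμ

/-- **LONG ZERO PIECES ARE DEC** (the zero-components of FOR-PROVERS-SINGLE-GATE §5 with an over-gate): under the single-gate hypothesis on `μ₁`
(as in `decAtT_longColumn`), a depth `h`, a gate `q ≤ γ ≤ 1` and a target `T ≤ q·(T₁ + h)`, the piece `gate (μ₁(· − h)) γ = (1−γ)δ₀ + γ·μ₁(·−h)`
is `DECAtT y T J M′` at every layer (`M′ ≥ M₁ + h`): the column at gate `q` is (`decAtT_longColumn`), re-gate (`decAtT_gate_mono`). [this work] -/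
theorem decAtT_zeroPiece_long (y q γ T : ℝ) (h M₁ M' : ℕ) (μ₁ : ℕ → ℝ) (hy0 : 0 < y) (hy1 : y < 1) (hq0 : 0 < q) (hqγ : q ≤ γ)
    (hγ1 : γ ≤ 1) (hyq : y ≤ q) (hμ0 : ∀ t, 0 ≤ μ₁ t) (hμM : ∀ t, M₁ < t → μ₁ t = 0) (hμ1 : ∑ t ∈ Finset.range (M₁ + 1), μ₁ t = 1)
    (hta : y * (M₁ : ℝ) ≤ q * ∑ t ∈ Finset.range (M₁ + 1), (t : ℝ) * μ₁ t)
    (hS : ∀ j, j < M₁ → DECAt y j M₁ (gate μ₁ q)) (hM' : M₁ + h ≤ M')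
    (hT : T ≤ q * (∑ t ∈ Finset.range (M₁ + 1), (t : ℝ) * μ₁ t + h)) (J : ℕ) :
    DECAtT y T J M' (gate (fun t => if h ≤ t then μ₁ (t - h) else 0) γ) := by
  obtain ⟨s0, sM, s1, -⟩ := shift_laws h M₁ μ₁ hμ0 hμM hμ1
  have eM : h + M₁ = M₁ + h := Nat.add_comm h M₁
  rw [eM] at sM s1
  exact decAtT_mono_top (decAtT_gate_mono y T q γ J (M₁ + h) _ hy0 hy1 hq0 hqγ hγ1 s0 sM s1
    (decAtT_longColumn y q T h M₁ (M₁ + h) μ₁ hy0 hy1 hq0 (hqγ.trans hγ1) hyq hμ0 hμM hμ1 hta hS le_rfl hT J)) hM'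

/-! ### Giant-topped pieces -/

/-- **GIANT-TOPPED PIECES ARE DEC AT ANY TARGET.**  For a two-point component `{lo, hi; γ}` with `γ ≥ y` whose top is a giant at the working
layer (`hi ≥ j + 1`) and any probability law `μ₂` on `{0..M₂}`, the piece `(1−γ)·μ₂(· − lo) + γ·μ₂(· − hi)` (= `{lo,hi;γ} ∗ μ₂`; for `lo = 0`
and `μ₂` replaced by its positive part this is the zero piece `gate_γ(S_hi μ₂)` of word `LGG`) is `DECAtT y T j M′` for EVERY target `T`
(`M′ ≥ hi + M₂`): all of the `hi`-copy sits above the layer, and criterion E `y/(1−y)·(1−γ) ≤ γ` is `y ≤ γ` (`flowAtT_of_giants`).  With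
`decAtT_shiftedFactor` (points) this makes the q < 1 slice piece-wise at every layer `j < M₁` except for the credit pairs `{lo < hi ≤ j}` of
the first factor's datum (arm-2 g32 census §4: "the whole non-piece-wise phenomenon lives at j ≥ M₁"). [this work] -/
theorem decAtT_giantToppedPiece (y T γ : ℝ) (j lo hi M₂ M' : ℕ) (μ₂ : ℕ → ℝ) (hy0 : 0 < y) (hy1 : y < 1)
    (hγy : y ≤ γ) (hγ1 : γ ≤ 1) (hμ0 : ∀ t, 0 ≤ μ₂ t) (hμM : ∀ t, M₂ < t → μ₂ t = 0)
    (hμ1 : ∑ t ∈ Finset.range (M₂ + 1), μ₂ t = 1) (hlohi : lo ≤ hi) (hhi : j + 1 ≤ hi) (hM' : hi + M₂ ≤ M') :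
    DECAtT y T j M' (fun t => (1 - γ) * (if lo ≤ t then μ₂ (t - lo) else 0) + γ * (if hi ≤ t then μ₂ (t - hi) else 0)) := by
  obtain ⟨a0, aM, a1, -⟩ := shift_laws lo M₂ μ₂ hμ0 hμM hμ1
  obtain ⟨b0, bM, b1, -⟩ := shift_laws hi M₂ μ₂ hμ0 hμM hμ1
  set A : ℕ → ℝ := fun t => if lo ≤ t then μ₂ (t - lo) else 0 with hA
  set B : ℕ → ℝ := fun t => if hi ≤ t then μ₂ (t - hi) else 0 with hB
  have h1γ : 0 ≤ 1 - γ := by linarith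
  have hγ0 : 0 ≤ γ := hy0.le.trans hγy
  have hP0 : ∀ t, 0 ≤ (1 - γ) * A t + γ * B t := fun t => add_nonneg (mul_nonneg h1γ (a0 t)) (mul_nonneg hγ0 (b0 t))
  have hPM : ∀ t, M' < t → (1 - γ) * A t + γ * B t = 0 := fun t ht => by
    rw [aM t (by omega), bM t (by omega)]; ring
  have hA1 : ∑ t ∈ Finset.range (M' + 1), A t = 1 := by
    rw [RootDec.sum_range_eq_of_vanish A (lo + M₂) M' (by omega) aM, a1]
  have hB1 : ∑ t ∈ Finset.range (M' + 1), B t = 1 := by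
    rw [RootDec.sum_range_eq_of_vanish B (hi + M₂) M' (by omega) bM, b1]
  have hP1 : ∑ t ∈ Finset.range (M' + 1), ((1 - γ) * A t + γ * B t) = 1 := by
    rw [Finset.sum_add_distrib, ← Finset.mul_sum, ← Finset.mul_sum, hA1, hB1]; ring
  refine decAtT_of_flowAtT y T j M' _ hy0 hy1 hPM hP1 (flowAtT_of_giants y T j M' _ hy0 hy1 hP0 ?_)
  have h1y : 0 < 1 - y := by linarith
  -- the lows carry at most the `lo`-copy's mass `1 − γ`
  have hBlow : ∀ l, l ≤ j → B l = 0 := fun l hl => by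
    simp only [hB, if_neg (show ¬ hi ≤ l by omega)]
  have hlow : ∑ l ∈ Finset.range (j + 1), (if 2 * (l : ℝ) < T then (1 - γ) * A l + γ * B l else 0) ≤ 1 - γ := by
    calc ∑ l ∈ Finset.range (j + 1), (if 2 * (l : ℝ) < T then (1 - γ) * A l + γ * B l else 0)
        ≤ ∑ l ∈ Finset.range (j + 1), (1 - γ) * A l := Finset.sum_le_sum fun l hl => by
          rw [hBlow l (by have := Finset.mem_range.1 hl; omega), mul_zero, add_zero]
          split_ifs
          · exact le_rfl
          · exact mul_nonneg h1γ (a0 l)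
      _ ≤ ∑ l ∈ Finset.range (M' + 1), (1 - γ) * A l :=
          Finset.sum_le_sum_of_subset_of_nonneg (Finset.range_subset_range.2 (by omega)) (fun l _ _ => mul_nonneg h1γ (a0 l))
      _ = 1 - γ := by rw [← Finset.mul_sum, hA1, mul_one]
  -- the giants carry all of the `hi`-copy's mass `γ`
  have hBg : ∑ h ∈ Finset.Ico (j + 1) (M' + 1), B h = 1 := by
    have := Finset.sum_range_add_sum_Ico B (show j + 1 ≤ M' + 1 by omega)
    rw [hB1, Finset.sum_eq_zero (fun l hl => hBlow l (by have := Finset.mem_range.1 hl; omega)), zero_add] at this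
    exact this
  have hgiant : γ ≤ ∑ h ∈ Finset.Ico (j + 1) (M' + 1), ((1 - γ) * A h + γ * B h) := by
    rw [Finset.sum_add_distrib, ← Finset.mul_sum, ← Finset.mul_sum, hBg, mul_one]
    have : 0 ≤ (1 - γ) * ∑ h ∈ Finset.Ico (j + 1) (M' + 1), A h := mul_nonneg h1γ (Finset.sum_nonneg fun h _ => a0 h)
    linarith
  have hE : y / (1 - y) * (1 - γ) ≤ γ := by
    rw [div_mul_eq_mul_div, div_le_iff₀ h1y]; nlinarith
  exact ((mul_le_mul_of_nonneg_left hlow (div_nonneg hy0.le h1y.le)).trans hE).trans hgiant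

end LawDec

end Quant

end Summit.CriticalPhenomena.PercolationContinuityZ3.Theorems
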